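import Mathlib.Analysis.Calculus.DSlope
import Mathlib.Analysis.Analytic.IsolatedZeros
import Mathlib.Analysis.SpecialFunctions.ExpDeriv
import Mathlib.Analysis.SpecialFunctions.Gaussian.FourierTransform
import Mathlib.Analysis.InnerProductSpace.Laplacian
import Mathlib.Analysis.Calculus.Gradient.Basic
import Mathlib.Analysis.InnerProductSpace.Calculus
import Mathlib.Analysis.Calculus.BumpFunction.Basic
import HarnessLib

/-!
# The Gaussian vortex on `ℝ²` and the asymmetric Burgers vortices of Gallay–Wayne / Maekawa

Analysis/FluidPDE definitions + named-facts file (work item `defn-BurgersVortexInStrain`, part (c);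
wanted by route `FrozenK41` of `AnomalousDissipation`). The planar (nondimensional, `γ = ν = 1`)
side of the Burgers vortex theory:

* `burgersPhi t = (1 − e^{−t})/t` (`= 1` at `t = 0`), the entire function behind all Burgers /
  Lamb–Oseen profiles, realised through Mathlib's `dslope` and proved real-analytic / smooth;
* `perp ξ = ξ^⊥ = (−ξ₁, ξ₀)`, the Gaussian vorticity profile `gaussVortexProfile = G`,
  `G(ξ) = (4π)⁻¹e^{−|ξ|²/4}`, `∫ G = 1` (proved), and its velocity `gaussVortexVelocity = v^G`,
  `v^G(ξ) = (2π|ξ|²)⁻¹(1 − e^{−|ξ|²/4}) ξ^⊥` (Gallay–Wayne 2006, (1.5); Gallay–Maekawa 2016, (1.12));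
* the two-dimensional Biot–Savart law `biotSavart2D ω = K_{2D} ∗ ω`, `K_{2D}(x) = x^⊥/(2π|x|²)`
  (Gallay–Wayne 2006, (1.3); Gallay–Maekawa 2016, (4.2));
* the stationary equation of STRAINED planar vorticity with asymmetry `λ` (Gallay–Wayne 2006,
  (1.7)–(1.8) with `∂ₜω = 0`; Gallay–Maekawa 2016, (4.2)–(4.3)):
  `(v·∇)ω = L_λ ω`, `L_λ = Δ + (1+λ)/2 x₁∂₁ + (1−λ)/2 x₂∂₂ + 1`, `v = K_{2D} ∗ ω`, in the classical
  (`IsClassicalAsymBurgersVortex`) and distributional (`IsWeakAsymBurgersVortex`) senses, and the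
  Gaussian-weighted norms `‖w‖²_Y = ∫ G⁻¹(w² + |∇w|²)` (Gallay–Wayne 2006, (1.9)), `L²(∞;λ)`
  (Gallay–Maekawa 2016, (4.6));
* NAMED FACTS: `GallayWayne2006_thm11` — existence of asymmetric Burgers vortices for ALL
  circulation Reynolds numbers `α` when `0 ≤ λ ≤ λ₀`, with the bounds `‖ω − αG‖_Y ≤ K₀`,
  `‖ω − αG‖_Y ≤ K₀(λ/λ₀)|α|/(1+|α|)` (Gallay–Wayne 2006, Thm. 1.1, existence part and p. 3
  properties); `GallayMaekawa2016_thm41` — existence for all `λ ∈ [0,1)` and all `α`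
  (Gallay–Maekawa 2016, Thm. 4.1 = Gallay–Wayne, Maekawa 2009a/b).

## What is NOT vendored (and why)

* The UNIQUENESS clause of Gallay–Wayne's Thm. 1.1 and Thm. 4.3 of the survey: their solution class
  is the fixed-point formulation (1.12) in the Hilbert space `Y`, not the classical one used here;
  restating uniqueness over classical solutions would not be the printed statement.
* The 2D / 3D STABILITY theorems (Gallay–Wayne 2006, Thm. 1.2; Gallay–Maekawa 2010 = survey Thm. 4.6):
  they need the mild-solution semiflow of (1.7) in `X`, resp. `BC(ℝ; L²(m))`, not in the tree.
* Kerr–Dold periodic vortex arrays in stagnation-point flow (Kerr–Dold 1994; Kerr 2024): found by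
  asymptotics and numerics, not a theorem in print — nothing to state as a fact.

## References

* Th. Gallay, C. E. Wayne, *Existence and stability of asymmetric Burgers vortices*, J. Math. Fluid
  Mech. 9 (2007) 243–261 = arXiv:math/0503353, §1: (1.1)–(1.9), Thm. 1.1 (PDF pp. 2–4). [GallayWayne2006]
* Th. Gallay, Y. Maekawa, *Existence and stability of viscous vortices*, arXiv:1610.08384, §1
  (1.11)–(1.12), §4 (4.1)–(4.6), Thm. 4.1 (PDF pp. 15–16). [GallayMaekawa2016]
* Y. Maekawa, *On the existence of Burgers vortices for high Reynolds numbers*, J. Math. Anal. Appl.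
  349 (2009) 181–200. [Maekawa2009]
-/

noncomputable section

open Set Function Filter Topology WithLp MeasureTheory
open scoped Laplacian InnerProductSpace RealInnerProductSpace ContDiff

namespace Literature.Analysis.FluidPDE

/-- Local notation for the plane `ℝ² = EuclideanSpace ℝ (Fin 2)`. -/
local notation "ℝ²" => EuclideanSpace ℝ (Fin 2)

/-! ### The profile function `φ(t) = (1 − e^{−t})/t` -/

/-- The **Burgers/Lamb–Oseen profile function** `φ(t) = (1 − e^{−t})/t` for `t ≠ 0`, `φ(0) = 1`:
the entire function `∑ (−t)ⁿ/(n+1)!`, realised as Mathlib's `dslope` of `t ↦ −e^{−t}` at `0`.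
All Burgers profiles are built from it: `(1 − e^{−ar²})/r² = a φ(ar²)` (Gallay–Wayne 2006, (1.5)).
[folklore] -/
def burgersPhi : ℝ → ℝ :=
  dslope (fun t => -Real.exp (-t)) 0

/-- `t φ(t) = 1 − e^{−t}` for every `t` (also at `t = 0`). [folklore] -/
theorem mul_burgersPhi (t : ℝ) : t * burgersPhi t = 1 - Real.exp (-t) := by
  have h := sub_smul_dslope (fun t => -Real.exp (-t)) 0 t
  simp only [sub_zero, smul_eq_mul, neg_zero, Real.exp_zero, sub_neg_eq_add] at h
  rw [burgersPhi, h]; ring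

/-- The closed form off the origin: `φ(t) = (1 − e^{−t})/t` for `t ≠ 0`. [folklore] -/
theorem burgersPhi_of_ne_zero {t : ℝ} (ht : t ≠ 0) : burgersPhi t = (1 - Real.exp (-t)) / t := by
  rw [← mul_burgersPhi, mul_div_cancel_left₀ _ ht]

/-- The value at the origin: `φ(0) = 1` (the derivative of `−e^{−t}` at `0`). [folklore] -/
@[simp] theorem burgersPhi_zero : burgersPhi 0 = 1 := by
  rw [burgersPhi, dslope_same]
  have h : HasDerivAt (fun t : ℝ => -Real.exp (-t)) (-(Real.exp (-0) * -1)) 0 :=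
    ((Real.hasDerivAt_exp (-0)).comp 0 (hasDerivAt_neg 0)).neg
  rw [h.deriv]; simp

/-- `φ` is real analytic on `ℝ` (removable singularity of an entire function). [folklore] -/
theorem analyticAt_burgersPhi (t : ℝ) : AnalyticAt ℝ burgersPhi t := by
  have hf : ∀ s : ℝ, AnalyticAt ℝ (fun t => -Real.exp (-t)) s := fun s =>
    ((analyticOnNhd_rexp (-s) (mem_univ _)).comp analyticAt_id.neg).neg
  by_cases ht : t = 0
  · subst ht
    obtain ⟨p, hp⟩ := hf 0
    exact hp.has_fpower_series_dslope_fslope.analyticAt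
  · have heq : burgersPhi =ᶠ[𝓝 t] slope (fun t => -Real.exp (-t)) 0 :=
      dslope_eventuallyEq_slope_of_ne _ ht
    refine AnalyticAt.congr ?_ heq.symm
    have : slope (fun t : ℝ => -Real.exp (-t)) 0 = fun s => (s - 0)⁻¹ * (-Real.exp (-s) - -Real.exp (-0)) := by
      funext s; rw [slope_def_field]; ring
    rw [this]
    exact ((analyticAt_id.sub analyticAt_const).inv (by simpa using ht)).mul
      ((hf t).sub analyticAt_const)

/-- **`φ` is smooth.** [folklore] -/
theorem contDiff_burgersPhi {n : WithTop ℕ∞} : ContDiff ℝ n burgersPhi :=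
  AnalyticOnNhd.contDiff fun t _ => analyticAt_burgersPhi t

/-- `φ > 0` everywhere. [folklore] -/
theorem burgersPhi_pos (t : ℝ) : 0 < burgersPhi t := by
  rcases lt_trichotomy t 0 with ht | rfl | ht
  · rw [burgersPhi_of_ne_zero ht.ne]
    apply div_pos_of_neg_of_neg _ ht
    have : 1 < Real.exp (-t) := Real.one_lt_exp_iff.2 (by linarith)
    linarith
  · simp
  · rw [burgersPhi_of_ne_zero ht.ne']
    apply div_pos _ ht
    have : Real.exp (-t) < 1 := Real.exp_lt_one_iff.2 (by linarith)
    linarith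

/-- `φ(t) ≤ 1` for `t ≥ 0` (from `1 − e^{−t} ≤ t`). [folklore] -/
theorem burgersPhi_le_one {t : ℝ} (ht : 0 ≤ t) : burgersPhi t ≤ 1 := by
  rcases ht.eq_or_lt with rfl | ht
  · simp
  · rw [burgersPhi_of_ne_zero ht.ne', div_le_one ht]
    have := Real.add_one_le_exp (-t)
    linarith

/-! ### The Gaussian vortex profiles `G`, `v^G` on `ℝ²` -/

/-- The planar rotation by `+π/2`: `ξ^⊥ = (−ξ₁, ξ₀)` (Gallay–Wayne 2006, after (1.3)). [cite: GallayWayne2006, (1.3)] -/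
def perp (ξ : ℝ²) : ℝ² :=
  toLp 2 ![-ξ 1, ξ 0]

/-- Components of `ξ^⊥`. [folklore] -/
@[simp] theorem perp_apply_zero (ξ : ℝ²) : perp ξ 0 = -ξ 1 := rfl

/-- Components of `ξ^⊥`. [folklore] -/
@[simp] theorem perp_apply_one (ξ : ℝ²) : perp ξ 1 = ξ 0 := rfl

/-- The **Gaussian vorticity profile** `G(ξ) = (4π)⁻¹ e^{−|ξ|²/4}` of the Lamb–Oseen and Burgers
vortices (Gallay–Wayne 2006, (1.5); Gallay–Maekawa 2016, (1.12)); `∫ G = 1`. [cite: GallayWayne2006, (1.5)] -/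
def gaussVortexProfile (ξ : ℝ²) : ℝ :=
  (4 * Real.pi)⁻¹ * Real.exp (-(‖ξ‖ ^ 2 / 4))

/-- The **velocity profile** `v^G(ξ) = (2π|ξ|²)⁻¹ (1 − e^{−|ξ|²/4}) ξ^⊥` of the Gaussian vortex
(Gallay–Wayne 2006, (1.5); Gallay–Maekawa 2016, (1.12)), written junk-free as
`(8π)⁻¹ φ(|ξ|²/4) ξ^⊥` with `φ = burgersPhi` (`gaussVortexVelocity_eq_of_ne_zero` recovers the
printed form for `ξ ≠ 0`; at `ξ = 0` both vanish). [cite: GallayWayne2006, (1.5)] -/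
def gaussVortexVelocity (ξ : ℝ²) : ℝ² :=
  ((8 * Real.pi)⁻¹ * burgersPhi (‖ξ‖ ^ 2 / 4)) • perp ξ

/-- The printed form of `v^G` off the origin. [cite: GallayWayne2006, (1.5)] -/
theorem gaussVortexVelocity_eq_of_ne_zero {ξ : ℝ²} (hξ : ξ ≠ 0) :
    gaussVortexVelocity ξ =
      ((2 * Real.pi * ‖ξ‖ ^ 2)⁻¹ * (1 - Real.exp (-(‖ξ‖ ^ 2 / 4)))) • perp ξ := by
  have hn : ‖ξ‖ ^ 2 / 4 ≠ 0 := by positivity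
  rw [gaussVortexVelocity, burgersPhi_of_ne_zero hn]
  congr 1
  field_simp
  ring

/-- `G > 0`. [folklore] -/
theorem gaussVortexProfile_pos (ξ : ℝ²) : 0 < gaussVortexProfile ξ := by
  unfold gaussVortexProfile; positivity

/-- `G` is smooth. [folklore] -/
theorem contDiff_gaussVortexProfile {n : WithTop ℕ∞} : ContDiff ℝ n gaussVortexProfile :=
  contDiff_const.mul (Real.contDiff_exp.comp ((contDiff_norm_sq ℝ).div_const _).neg)

/-- **`∫_{ℝ²} G = 1`** (Gallay–Maekawa 2016, after (1.12); Gaussian integral `∫ e^{−|ξ|²/4} = 4π`). [cite: GallayMaekawa2016, (1.12)] -/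
theorem integral_gaussVortexProfile : ∫ ξ : ℝ², gaussVortexProfile ξ = 1 := by
  have hb : (0 : ℝ) < 1 / 4 := by norm_num
  have hG := GaussianFourier.integral_rexp_neg_mul_sq_norm (V := ℝ²) hb
  rw [finrank_euclideanSpace_fin, show ((2 : ℕ) : ℝ) / 2 = 1 by norm_num, Real.rpow_one] at hG
  have h : ∀ ξ : ℝ², gaussVortexProfile ξ = (4 * Real.pi)⁻¹ * Real.exp (-(1 / 4) * ‖ξ‖ ^ 2) :=
    fun ξ => by rw [gaussVortexProfile]; congr 2; ring
  simp_rw [h, MeasureTheory.integral_const_mul, hG]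
  field_simp

/-! ### The planar Biot–Savart law and the strained vorticity equation -/

/-- The two-dimensional **Biot–Savart kernel** `K_{2D}(x) = x^⊥/(2π|x|²)` (Gallay–Wayne 2006,
(1.3); Gallay–Maekawa 2016, after (4.2)). Junk value `0` at `x = 0` (`0⁻¹ = 0`), a null set. [cite: GallayWayne2006, (1.3)] -/
def biotSavartKernel2D (x : ℝ²) : ℝ² :=
  (2 * Real.pi * ‖x‖ ^ 2)⁻¹ • perp x

/-- The kernel vanishes at the origin (documented junk value). [folklore] -/
@[simp] theorem biotSavartKernel2D_zero : biotSavartKernel2D 0 = 0 := by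
  simp [biotSavartKernel2D]

/-- The two-dimensional **Biot–Savart law** `v = K_{2D} ∗ ω`,
`v(x) = (2π)⁻¹ ∫ (x − y)^⊥ |x − y|⁻² ω(y) dy`, recovering the divergence-free velocity with
`∂₁v₂ − ∂₂v₁ = ω` (Gallay–Wayne 2006, (1.3)). Bochner integral (junk value `0` at the points where
`y ↦ ω(y) K(x − y)` is not integrable — a null set for `ω ∈ L¹ ∩ L^p`, `p > 2`). [cite: GallayWayne2006, (1.3)] -/
def biotSavart2D (w : ℝ² → ℝ) (x : ℝ²) : ℝ² :=
  ∫ y, w y • biotSavartKernel2D (x - y)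

/-- The **strained-vorticity operator** `L_λ = Δ + (1+λ)/2 x₁∂₁ + (1−λ)/2 x₂∂₂ + 1 = L + λM`
of the nondimensional (`γ = ν = 1`) Burgers problem with asymmetry `λ` (Gallay–Wayne 2006, (1.8):
`L = Δ + ½x·∇ + 1`, `M = ½(x₁∂₁ − x₂∂₂)`; Gallay–Maekawa 2016, (4.3)). Indices `0, 1` in Lean;
`∂ᵢω(x) = Dω(x) eᵢ`. [cite: GallayMaekawa2016, (4.3)] -/
def strainedVorticityOperator (lam : ℝ) (w : ℝ² → ℝ) (x : ℝ²) : ℝ :=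
  Δ w x + (1 + lam) / 2 * x 0 * fderiv ℝ w x (EuclideanSpace.single 0 1) +
    (1 - lam) / 2 * x 1 * fderiv ℝ w x (EuclideanSpace.single 1 1) + w x

/-- **Classical asymmetric Burgers vortex** with asymmetry `λ` and circulation `α`
(Gallay–Maekawa 2016, (4.2); Gallay–Wayne 2006, (1.7) with `∂ₜω = 0`): a smooth integrable planar
vorticity `ω` with `L_λ ω = (v·∇)ω` pointwise, `v = K_{2D} ∗ ω` given by absolutely convergent
Biot–Savart integrals, and `∫ ω = α`. (The dimensional vortex in the strain
`asymmetricStrain γ λ` with viscosity `ν` is `(γ) ω(x√(γ/ν)) e_z`, Gallay–Wayne 2006, p. 3.) [cite: GallayMaekawa2016, (4.2)] -/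
structure IsClassicalAsymBurgersVortex (lam α : ℝ) (w : ℝ² → ℝ) : Prop where
  /-- `ω ∈ C^∞(ℝ²)`. -/
  smooth : ContDiff ℝ ∞ w
  /-- `ω ∈ L¹(ℝ²)`. -/
  integrable : Integrable w
  /-- The Biot–Savart integrals converge absolutely at every point. -/
  kernel_integrable : ∀ x, Integrable (fun y => w y • biotSavartKernel2D (x - y))
  /-- The stationary equation `(v·∇)ω = L_λ ω` (Gallay–Maekawa 2016, (4.2)). -/
  equation : ∀ x, ⟪biotSavart2D w x, gradient w x⟫ = strainedVorticityOperator lam w x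
  /-- Total circulation `∫ ω = α`. -/
  circulation : ∫ x, w x = α

/-- **Weak (distributional) asymmetric Burgers vortex** (Gallay–Maekawa 2016, (4.2) tested against
`φ ∈ C_c^∞(ℝ²)`, using `div v = 0`): `ω ∈ L¹` with `∫ ω = α`, `ω v ∈ L¹_loc` for `v = K_{2D} ∗ ω`, and
`∫ ω (Δφ − ½((1+λ)x₁∂₁φ + (1−λ)x₂∂₂φ) + v·∇φ) = 0` for every test function `φ`
(the adjoint of `L_λ − v·∇`; the zero-order terms cancel since `(1+λ)/2 + (1−λ)/2 = 1`). [cite: GallayMaekawa2016, (4.2)] -/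
def IsWeakAsymBurgersVortex (lam α : ℝ) (w : ℝ² → ℝ) : Prop :=
  Integrable w ∧ ∫ x, w x = α ∧
    LocallyIntegrable (fun x => w x • biotSavart2D w x) ∧
    ∀ φ : ℝ² → ℝ, ContDiff ℝ ∞ φ → HasCompactSupport φ →
      ∫ x, w x * (Δ φ x - ((1 + lam) / 2 * x 0 * fderiv ℝ φ x (EuclideanSpace.single 0 1) +
          (1 - lam) / 2 * x 1 * fderiv ℝ φ x (EuclideanSpace.single 1 1)) +
        ⟪biotSavart2D w x, gradient φ x⟫) = 0

/-! ### Gaussian-weighted spaces -/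

/-- The squared norm of Gallay–Wayne's weighted Sobolev space `Y`:
`‖w‖²_Y = ∫ G(x)⁻¹ (w(x)² + |∇w(x)|²) dx` (Gallay–Wayne 2006, (1.9) and the display after it).
Bochner integral; used together with the integrability of the integrand. [cite: GallayWayne2006, (1.9)] -/
def gwSobolevNormSq (w : ℝ² → ℝ) : ℝ :=
  ∫ x, (gaussVortexProfile x)⁻¹ * (w x ^ 2 + ‖gradient w x‖ ^ 2)

/-- Membership in Gallay–Wayne's space `Y` (minus the zero-mean condition, stated separately):
`w` is `C¹` and `G⁻¹(w² + |∇w|²)` is integrable (Gallay–Wayne 2006, (1.9)). [cite: GallayWayne2006, (1.9)] -/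
def MemGWSobolev (w : ℝ² → ℝ) : Prop :=
  ContDiff ℝ 1 w ∧ Integrable (fun x => (gaussVortexProfile x)⁻¹ * (w x ^ 2 + ‖gradient w x‖ ^ 2))

/-- The asymmetric Gaussian weight `G_λ(x) = (1−λ)/(4π) e^{−(1−λ)|x|²/4}` (Gallay–Maekawa 2016,
(4.6)); `G₀ = G`. [cite: GallayMaekawa2016, (4.6)] -/
def gaussWeightLam (lam : ℝ) (x : ℝ²) : ℝ :=
  (1 - lam) / (4 * Real.pi) * Real.exp (-((1 - lam) / 4 * ‖x‖ ^ 2))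

/-- `G₀ = G`. [folklore] -/
@[simp] theorem gaussWeightLam_zero : gaussWeightLam 0 = gaussVortexProfile := by
  funext x; simp [gaussWeightLam, gaussVortexProfile]; ring_nf

/-- Membership in `L²(∞;λ)`: `∫ |f|² / G_λ < ∞` (Gallay–Maekawa 2016, (4.6)). [cite: GallayMaekawa2016, (4.6)] -/
def MemL2InftyLam (lam : ℝ) (f : ℝ² → ℝ) : Prop :=
  AEStronglyMeasurable f volume ∧ Integrable (fun x => f x ^ 2 / gaussWeightLam lam x)

/-! ### Named facts: existence of asymmetric Burgers vortices -/

/-- **Gallay–Wayne 2006, Theorem 1.1 (existence part).** There exist `λ₀ > 0` and `K₀ > 0` such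
that for all `λ ∈ [0, λ₀]` and ALL `α ∈ ℝ` (every circulation Reynolds number) the nondimensional
strained vorticity equation (1.7) has a stationary solution `ω^{α,λ}` — an asymmetric Burgers
vortex — with `‖ω^{α,λ} − αG‖_Y ≤ K₀` and moreover `‖ω^{α,λ} − αG‖_Y ≤ K₀ (λ/λ₀) |α|/(1+|α|)`;
`ω^{α,λ}` is a smooth function of `x` with `∫ ω^{α,λ} = α` (p. 3). Vendored over the classical
formulation `IsClassicalAsymBurgersVortex` (the printed solutions are smooth with Gaussian decay);
the printed UNIQUENESS in the `Y`-ball refers to the fixed-point class (1.12) and is deliberately not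
restated here. [cite: GallayWayne2006, Thm. 1.1] -/
def GallayWayne2006_thm11 : Prop :=
  ∃ lam0 : ℝ, 0 < lam0 ∧ ∃ K0 : ℝ, 0 < K0 ∧
    ∀ lam ∈ Set.Icc (0 : ℝ) lam0, ∀ α : ℝ, ∃ w : ℝ² → ℝ,
      IsClassicalAsymBurgersVortex lam α w ∧
      MemGWSobolev (fun x => w x - α * gaussVortexProfile x) ∧
      gwSobolevNormSq (fun x => w x - α * gaussVortexProfile x) ≤ K0 ^ 2 ∧
      gwSobolevNormSq (fun x => w x - α * gaussVortexProfile x) ≤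
        (K0 * (lam / lam0) * (|α| / (1 + |α|))) ^ 2

/-- **Gallay–Maekawa 2016, Theorem 4.1 (existence for every asymmetry and circulation).** For
all `λ ∈ [0, 1)` and all `α ∈ ℝ` there exists at least one asymmetric Burgers vortex
`ω_{λ,α} ∈ L²(∞;λ)` satisfying (4.2) (Gallay–Wayne 2006 for `0 ≤ λ ≪ ½`; Gallay–Wayne, Physica D
213 (2006) for small `|α|`; Maekawa 2009 (JMAA 349) for `λ < ½`, `|α| ≫ 1`; Maekawa 2009 (M3AS 19)
in general, by Leray–Schauder). Vendored with (4.2) in the distributional sense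
(`IsWeakAsymBurgersVortex`). [cite: GallayMaekawa2016, Thm. 4.1] -/
def GallayMaekawa2016_thm41 : Prop :=
  ∀ lam ∈ Set.Ico (0 : ℝ) 1, ∀ α : ℝ, ∃ w : ℝ² → ℝ,
    IsWeakAsymBurgersVortex lam α w ∧ MemL2InftyLam lam w

end Literature.Analysis.FluidPDE
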